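import Summits.KontsevichZagierPeriods.KontsevichZagierPeriods.Theorems.RootDecompZetaThreeFrontierNBCSpanFourP19
import Summits.KontsevichZagierPeriods.KontsevichZagierPeriods.Theorems.RootDecompZetaThreeFrontierCellZetaFourP11

/-! # `CellZeta 4` and RUNG 4 ⟸ (A₄) — the in-tree COMBINATION of LEVEL 1 (`…CellZetaFourP01–P11`, JOB C certificate:
`cellZeta_four_of_NBCSpan`, `gzNormalFormW_four_of_polar`) and LEVEL 2 (`…NBCSpanFourP01–P19`: `nbcSpan_four`).
Source: decomp-kz lens-1 g13 `COMBINATION.lean` @a2f654c6 (critic CLEARED g6-20, STATUS l.1368); landed by census-1 g10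
`--supports stmt-KontsevichZagierPeriods-27141` (GZNormalFormWFour; rung 4 of the genus-zero ladder is now
`GZNormalFormW 4 ⟸ PolarReduction 4` with `CellZeta 4` a THEOREM). -/

set_option linter.dupNamespace false
noncomputable section

namespace Summit.KontsevichZagierPeriods.KontsevichZagierPeriods.Cruxes.GZNormalFormWThree.GZLadder.CellZetaFour

open Summit.KontsevichZagierPeriods.KontsevichZagierPeriods.Cruxes.GZNormalFormWThree.GZLadder.RungFour
open Summit.KontsevichZagierPeriods.KontsevichZagierPeriods.Theorems.RootDecompZetaThreeFrontierWordEdge (GZNormalFormW)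

/-- **(C₄) CELL-ZETA REDUCTION in dimension 4**: every cell-zeta class of `Δ₄` (integrand a product of inverse chord forms over an
NBC frame, times a monomial numerator of admissible weight) is congruent into `cellGens 4 ∪ gzLT 4` — LEVEL 1 (the 98 × 98 residue
certificate) composed with LEVEL 2 (the NBC span table). [proof of this node's piece CellZeta 4] -/
theorem cellZeta_four : CellZeta 4 := cellZeta_four_of_NBCSpan nbcSpan_four

/-- **RUNG 4 ⟸ (A₄)**: given the polar reduction `PolarReduction 4`, the weight-4 genus-zero normal form `GZNormalFormW 4` holds
(rung 3 = the landed `GZNormalFormWThree_kernel`, item 32433; cell-zeta = `cellZeta_four`). -/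
theorem gzNormalFormW_four_of (hA : PolarReduction 4) : GZNormalFormW 4 := gzNormalFormW_four_of_polar nbcSpan_four hA

/-- **ITEM 27141 `GZNormalFormWFour` ⟸ `PolarReduction 4`, BY THE ITEM'S OWN NAME**: the registered support item of route A‴
(`Theses.RootDecompZetaThreeFrontier.GZNormalFormWFour` = the inlined body of `GZNormalFormW 4`, rank 9, deps [HigherWeightDescent])
follows from the one open leaf `PolarReduction 4` (⟸ `LAYER₄`, cf. `…GZLadderFourPolarP01–P13`): `CellZeta 4` and rung 3 are discharged
in the tree (critic g6-20 probe `critic_rung4`, by `defeq`). -/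
theorem gzNormalFormWFour_of_polar (hA : PolarReduction 4) :
    Summit.KontsevichZagierPeriods.KontsevichZagierPeriods.Theses.RootDecompZetaThreeFrontier.GZNormalFormWFour :=
  gzNormalFormW_four_of hA

end Summit.KontsevichZagierPeriods.KontsevichZagierPeriods.Cruxes.GZNormalFormWThree.GZLadder.CellZetaFour
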